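import Summits.ABC.IUTFork.Cor312CapstoneWitnessNV
import HarnessLib

/-!
# TEAM B capstone witness, CONTENTFUL upgrade, part B: the capstone applies, the residual input fails

Record-only, proof-side companion (D-0012) of `Cor312CapstoneWitnessNV` (abc-iut cell, Cor. 3.12
STRATEGY TEAM B «estimate / log-Kummer», HUMAN RULING D-0067 (3), seat abc-iut-c312-11 = B1;
NV-parity with Team A's p414526); TAKES NO SIDE. Part NVA built the CONTENTFUL full situation
`nvFull` (non-identity (Ind2) indeterminacies, proper integral structures, nonempty splitting
monoids; typed Theorem 3.11 TRUE). THIS file puts the verbatim `Cor312.Setting` on it and closes the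
degeneracy objection to the capstone-premise independence (p416604/p416831):

* `nvSetting` — Θ-pilot Kummer images `{0}` (volume `1/4`), `q`-pilot image everything (volume
  `1/2`), hull frame `{{0}, univ}`; `−|log(Θ)| = log(1/4)`, `−|log(q)| = log(1/2)`.
* `nvSetting_bridgeHyps` / `nvSetting_thetaRegionsAdm` / `nvSetting_absLogQPos` — every bridge
  hypothesis, admissibility of the Kummer images, `|log(q)| > 0` — while the typed Corollary 3.12
  FAILS (`nvSetting_not_statement`).
* `capstone_at_nv` — the TEAM B capstone instantiated at the contentful witness: all twelve Haar
  side conditions discharged (`nvMap_comp_linearEquiv` intertwines EVERY indeterminacy — in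
  particular the genuinely non-identity `negFamily` — with the identity of the container), leaving
  exactly `QFrobEqualityAt nvSetting 0 → nvSetting.Statement`.
* `nvSetting_not_qFrobEqualityAt` / `…_not_qFrobComparison` — the residual input fails at EVERY
  lattice position, and so does its `≤`-form.
* `capstonePremisesNV_not_imp_qFrobEqualityAt` — the ∃-form WITH the contentful clauses (some
  (Ind2) indeterminacy moves a nonzero packet element; the integral structures are proper; the
  splitting monoids have nonzero members): the capstone's premise set remains jointly satisfiable,
  non-trivialising and consistent with the negation of its residual input in a NON-degenerate
  instantiation — the degeneracy objection to p416604/p416831 is closed.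

HONEST SCOPE: interface-level, toy carriers; the glue fields remain free (every (G3) countermodel of
record is relative to the FREE Θ/q-glue typing — ref-v FAITHFUL-A2 02:01:30Z); whether the residual
comparison holds for the ASSEMBLED real setting is GAP row G-c312-11-1, not decided here. Sources:
[IUTchIII] pp. 173–175, p. 184 l. 30–34 (Step (xi-g)). [claim: Mochizuki2012, status: disputed]
[cite: MochizukiAbsTopIII2015, Prop. 5.7 (i) pp. 137–138] [cite: ScholzeStix2018, §2.2 pp. 9–10]
Deliberately NOT here: any real-setting discharge, any judgement on Cor. 3.12 or its gap rows.
-/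

noncomputable section

namespace Summit.ABC

namespace IUTFork

namespace Cor312Vol

namespace CapstoneWitness

open Thm311 Cor312 Cor312.Checks Cor312Vol.GapWitness Literature.IUT.LogVolume
  Literature.IUT.LogThetaLattice MeasureTheory Set
open scoped ENNReal Pointwise

/-! ## 1. The setting over the contentful situation -/

/-- The SETTING of the contentful witness over `nvSituation`: lattice `^{n,m}𝓗𝓣 := (n, m)`,
one-point pilots, hull frame `{{0}, univ}`; the Θ-pilot Kummer image is `{0}` at every `m`, the
`q`-pilot image is everything. [folklore] -/
def nvSetting : Setting nvSituation where
  n := 0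
  HT := ℤ × ℤ
  LogLink := fun _ _ => Unit
  IsFull := fun _ => True
  lattice :=
    { theater := fun n m => (n, m)
      distinct := fun p q h => by simpa using h
      logLink := fun _ _ => ()
      logLink_full := fun _ _ => trivial }
  Frd := Unit
  IsoF := fun _ _ => Unit
  Ob := fun _ => Unit
  realify := id
  Strip := Unit
  IsoS := fun _ _ => Unit
  M := fun _ _ => Unit
  sig := toySig
  split := { Msplit := fun _ _ => ⊤, exists_gen := fun _ _ => ⟨⟨(), trivial⟩, top_unit_isGenerator _⟩ }
  ObΔ := Unit
  N := fun _ _ => Unit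
  qData := { q := fun _ _ => (), q_gen := fun _ _ => unit_isGenerator _, objOf := fun _ => () }
  frame := fun j vQ => gapFrame _
  hul_adm := fun j vQ H hH => by
    rcases hH with rfl | rfl
    · exact (nvAdm_iff_nonempty j vQ _).2 ⟨0, rfl⟩
    · exact (nvAdm_iff_nonempty j vQ _).2 ⟨0, Set.mem_univ 0⟩
  thetaRegionOf := fun _ _ _ _ => {0}
  qRegionOf := fun _ _ _ => Set.univ
  qRegion_mem := fun _ _ => Set.mem_insert_of_mem _ rfl
  qSupport_finite := fun _ => Set.toFinite _

/-- The (Ind3)-enlarged Θ-pilot region is `{0}` in every packet. [folklore] -/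
theorem nv_thetaRegion3 (j : toyIndex.Label) (vQ : toyIndex.VQ) :
    nvSetting.thetaRegion3 j vQ = {0} := by
  show (⋃ _ : ℤ, ({0} : Set (nvShells.Packet j vQ))) = {0}
  exact Set.iUnion_const _

/-- The possible images are exactly `{0}` (linear equivalences fix `0` — in particular the
genuinely non-identity indeterminacies of the contentful shells). [folklore] -/
theorem nv_mem_possibleImages_iff (j : toyIndex.Label) (vQ : toyIndex.VQ)
    (U : Set (nvShells.Packet j vQ)) :
    U ∈ nvSetting.possibleImages j vQ ↔ U = {0} := by
  constructor
  · rintro ⟨Φ, -, rfl⟩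
    rw [nv_thetaRegion3, Set.image_singleton, map_zero]
    rfl
  · rintro rfl
    exact nv_thetaRegion3 j vQ ▸ nvSetting.thetaRegion3_mem_possibleImages j vQ

/-- The union of the possible images is `{0}`. [folklore] -/
theorem nv_sUnion_possibleImages (j : toyIndex.Label) (vQ : toyIndex.VQ) :
    ⋃₀ nvSetting.possibleImages j vQ = ({0} : Set (nvShells.Packet j vQ)) := by
  ext x
  simp only [Set.mem_sUnion]
  constructor
  · rintro ⟨U, hU, hx⟩
    rwa [(nv_mem_possibleImages_iff j vQ U).1 hU] at hx
  · intro hx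
    exact ⟨{0}, (nv_mem_possibleImages_iff j vQ _).2 rfl, hx⟩

/-- The packet hull of the contentful witness is `{0}`. [folklore] -/
theorem nv_thetaHull (j : toyIndex.Label) (vQ : toyIndex.VQ) :
    nvSetting.thetaHull j vQ = ({0} : Set (nvShells.Packet j vQ)) := by
  refine Set.Subset.antisymm ?_ ?_
  · show (gapFrame _).hull (⋃₀ nvSetting.possibleImages j vQ) ⊆ {0}
    exact gapFrame_hull_of_subset (nv_sUnion_possibleImages j vQ).le
  · exact ((nv_sUnion_possibleImages j vQ).symm.le).trans
      ((gapFrame (nvShells.Packet j vQ)).subset_hull (⋃₀ nvSetting.possibleImages j vQ))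

/-- Every union of possible images admits its hull. [folklore] -/
theorem nv_hullDefined (j : toyIndex.Label) (vQ : toyIndex.VQ) :
    nvSetting.HullDefined j vQ := ⟨trivial, trivial⟩

/-- The local Θ-contribution is `log(1/4)` in every packet. [folklore] -/
theorem nv_thetaLocal (j : toyIndex.Label) (vQ : toyIndex.VQ) :
    nvSetting.thetaLocal j vQ = ((Real.log 4⁻¹ : ℝ) : WithTop ℝ) := by
  unfold Setting.thetaLocal
  rw [if_pos (nv_hullDefined j vQ)]
  show ((nvVol j vQ (nvSetting.thetaHull j vQ) : ℝ) : WithTop ℝ) = _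
  rw [nv_thetaHull, nvVol_zero]

/-- The local `q`-contribution is `log(1/2)` in every packet. [folklore] -/
theorem nv_qLocal (j : toyIndex.Label) (vQ : toyIndex.VQ) :
    nvSetting.qLocal j vQ = Real.log 2⁻¹ :=
  nvVol_univ j vQ

/-- The contentful witness is `ThetaFinite`. [folklore] -/
theorem nv_thetaFinite : nvSetting.ThetaFinite :=
  ⟨fun i vQ => by rw [nv_thetaLocal]; exact WithTop.coe_ne_top, fun _ => Set.toFinite _⟩

/-- `−|log(Θ)| = log(1/4)` at the contentful witness. [folklore] -/
theorem nv_negLogTheta : nvSetting.negLogTheta = ((Real.log 4⁻¹ : ℝ) : WithTop ℝ) := by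
  unfold Setting.negLogTheta
  rw [if_pos nv_thetaFinite]
  have h : ∀ i : Fin toyIndex.lstar,
      (∑ᶠ vQ : toyIndex.VQ, (nvSetting.thetaLocal (Setting.labelSucc i) vQ).untopD 0) =
        Real.log 4⁻¹ := by
    intro i
    have h1 : (fun vQ : toyIndex.VQ =>
        (nvSetting.thetaLocal (Setting.labelSucc i) vQ).untopD 0) = fun _ => Real.log 4⁻¹ := by
      funext vQ
      rw [nv_thetaLocal, WithTop.untopD_coe]
    rw [h1, finsum_unique]
  simp only [h]
  exact congrArg _ (processionNormalized_const (by decide) _)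

/-- `−|log(q)| = log(1/2)` at the contentful witness. [folklore] -/
theorem nv_negLogQ : nvSetting.negLogQ = Real.log 2⁻¹ := by
  unfold Setting.negLogQ
  have h : ∀ i : Fin toyIndex.lstar,
      (∑ᶠ vQ : toyIndex.VQ, nvSetting.qLocal (Setting.labelSucc i) vQ) = Real.log 2⁻¹ := by
    intro i
    have h1 : (fun vQ : toyIndex.VQ => nvSetting.qLocal (Setting.labelSucc i) vQ) =
        fun _ => Real.log 2⁻¹ := by
      funext vQ
      exact nv_qLocal _ vQ
    rw [h1, finsum_unique]
  simp only [h]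
  exact processionNormalized_const (by decide) _

/-! ## 2. Bridge hypotheses, positivity, failure of the Corollary -/

/-- All bridge hypotheses hold at the contentful witness. [folklore] -/
theorem nvSetting_bridgeHyps : BridgeHyps nvSetting where
  mono := fun i vQ A B hA hB hAB => nvVol_mono hA hB hAB
  image_adm := fun i vQ U hU => by
    rw [(nv_mem_possibleImages_iff _ vQ U).1 hU]
    exact (nvAdm_iff_nonempty _ vQ _).2 ⟨0, rfl⟩
  image_fin := fun _ => Set.toFinite _
  hul_nonempty := fun j vQ H hH => by
    rcases hH with rfl | rfl
    · exact ⟨0, rfl⟩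
    · exact ⟨0, Set.mem_univ 0⟩
  theta_nonempty := fun i vQ => by
    rw [nv_thetaRegion3]
    exact ⟨0, rfl⟩
  finite := nv_thetaFinite

/-- The Kummer images are admissible at the contentful witness. [folklore] -/
theorem nvSetting_thetaRegionsAdm : ThetaRegionsAdm nvSetting := fun _ _ vQ =>
  (nvAdm_iff_nonempty _ vQ _).2 ⟨0, rfl⟩

/-- `|log(q)| > 0` at the contentful witness. [folklore] -/
theorem nvSetting_absLogQPos : nvSetting.AbsLogQPos := by
  show nvSetting.negLogQ < 0
  rw [nv_negLogQ]
  exact log_half_neg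

/-- **The typed Corollary 3.12 FAILS at the contentful witness.** [folklore] -/
theorem nvSetting_not_statement : ¬ nvSetting.Statement := by
  rintro ⟨-, hle⟩
  rw [nv_negLogQ, nv_negLogTheta, WithTop.coe_le_coe] at hle
  exact absurd hle (not_le.2 log_quarter_lt_log_half)

/-! ## 3. The capstone instantiated at the contentful witness -/

/-- **The TEAM B capstone applies at the contentful witness**: all twelve Haar side conditions are
discharged over the honest `ZMod 4` container — the intertwining `nvMap_comp_linearEquiv` works for
EVERY `ℚ`-linear indeterminacy, in particular for the genuinely non-identity `negFamily` — leaving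
exactly `QFrobEqualityAt nvSetting 0 → nvSetting.Statement`.
[claim: Mochizuki2012, status: disputed] -/
theorem capstone_at_nv :
    QFrobEqualityAt (S' := nvFull.toLatticeSituation) nvSetting 0 → nvSetting.Statement := by
  intro hQ
  refine teamB_capstone_of_latticeRealisations (S'' := nvFull) nvSetting
    (W := fun _ _ => ZMod 4) (fun _ _ => Lam4) (fun _ _ => 1) nvMap
    (fun _ _ _ => ContinuousAddEquiv.refl (ZMod 4)) (fun _ _ => {0})
    (fun j vQ A => rfl) (fun j vQ A => Iff.rfl) ?_ ?_ ?_ ?_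
    (fun i vQ A B hA hB hAB => nvVol_mono hA hB hAB) ?_ (fun _ => Set.toFinite _) ?_ ?_
    nv_thetaFinite nvFull_statement hQ
  · -- hInd: every generator — including the non-identity ones — is realised by the identity
    -- homeomorphism of the container (linear equivalences fix 0 and nonzero-ness).
    intro Φ hΦ j vQ
    refine ⟨ContinuousAddEquiv.refl (ZMod 4), Lam4, by simp, fun x => ?_⟩
    show nvMap j vQ (Φ j vQ x) = nvMap j vQ x
    exact nvMap_comp_linearEquiv (Φ j vQ) x
  · -- hψ: the identity maps the integral structure onto itself.
    intro m j vQ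
    exact ⟨Lam4, by simp⟩
  · -- hthetaEq: every Kummer image {0} is the identity image of the reference region {0}.
    intro m i vQ
    show nvMap _ vQ '' ({0} : Set (nvShells.Packet _ vQ)) =
      ⇑(ContinuousAddEquiv.refl (ZMod 4)) '' (nvMap _ vQ '' ({0} : Set (nvShells.Packet _ vQ)))
    rw [nvMap_image_zero]
    simp
  · -- hR: the reference regions have positive finite volume.
    intro i vQ
    exact Lam4_haar_pos_lt_top (Set.image_nonempty.2 ⟨0, rfl⟩)
  · -- h3adm: the (Ind3)-enlarged regions are admissible.
    intro i vQ
    exact Lam4_haar_pos_lt_top (Set.image_nonempty.2 ⟨0, Set.mem_iUnion.2 ⟨0, rfl⟩⟩)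
  · -- hulne: hull-sets are nonempty.
    exact nvSetting_bridgeHyps.hul_nonempty
  · -- h3ne: the (Ind3)-enlarged regions are nonempty.
    exact nvSetting_bridgeHyps.theta_nonempty

/-! ## 4. The residual input still fails -/

/-- The residual B-INPUT (uniform equality form) FAILS at every lattice position. [folklore] -/
theorem nvSetting_not_qFrobEqualityAt (m : ℤ) :
    ¬ QFrobEqualityAt (S' := nvFull.toLatticeSituation) nvSetting m := by
  intro h
  have h0 : nvVol (Setting.labelSucc ⟨0, by decide⟩) () Set.univ =
      nvVol (Setting.labelSucc ⟨0, by decide⟩) ()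
        ({0} : Set (nvShells.Packet (Setting.labelSucc ⟨0, by decide⟩) ())) :=
    h ⟨0, by decide⟩ ()
  rw [nvVol_univ, nvVol_zero] at h0
  exact absurd h0 log_quarter_lt_log_half.ne'

/-- The `≤`-form fails too. [folklore] -/
theorem nvSetting_not_qFrobComparison :
    ¬ QFrobComparison (S' := nvFull.toLatticeSituation) nvSetting := by
  intro h
  obtain ⟨m, hm⟩ := h ⟨0, by decide⟩ ()
  have hm' : nvVol (Setting.labelSucc ⟨0, by decide⟩) () Set.univ ≤
      nvVol (Setting.labelSucc ⟨0, by decide⟩) ()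
        ({0} : Set (nvShells.Packet (Setting.labelSucc ⟨0, by decide⟩) ())) := hm
  rw [nvVol_univ, nvVol_zero] at hm'
  exact absurd hm' (not_le.2 log_quarter_lt_log_half)

/-! ## 5. The ∃-form with the contentful clauses -/

/-- **(G3) FOR THE CAPSTONE PREMISE SET, CONTENTFUL INSTANTIATION** (NV-parity with p414526; the
degeneracy objection to p416604/p416831 closed): there is an instantiation in which the TEAM B
capstone's entire premise set holds — typed Theorem 3.11 in full, all twelve Haar side conditions
(witnessed by the instantiated capstone implication) — together with every bridge hypothesis,
`|log(q)| > 0` and admissible Kummer images, while the residual input fails at EVERY lattice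
position with its `≤`-form and the typed Corollary 3.12 fails; AND the instantiation is
NON-degenerate: some (Ind2) indeterminacy moves a nonzero packet element, the integral structures
are proper, and the splitting monoids have nonzero members. The glue fields remain free (the honest
relativity of every (G3) countermodel of record). [folklore] -/
theorem capstonePremisesNV_not_imp_qFrobEqualityAt :
    ∃ (T : ThetaIndex) (F : FullSituation T) (P : Cor312.Setting F.toLatticeSituation.toSituation),
      F.Statement ∧ BridgeHyps P ∧ P.AbsLogQPos ∧ ThetaRegionsAdm P ∧
        (QFrobEqualityAt (S' := F.toLatticeSituation) P 0 → P.Statement) ∧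
        (∀ m : ℤ, ¬ QFrobEqualityAt (S' := F.toLatticeSituation) P m) ∧
        ¬ QFrobComparison (S' := F.toLatticeSituation) P ∧ ¬ P.Statement ∧
        (∃ Φ ∈ F.L.Ind2Family, ∃ (j : T.Label) (vQ : T.VQ) (y : F.L.Packet j vQ), Φ j vQ y ≠ y) ∧
        (∀ (v : T.V) (hv : v ∈ T.Vbad), ∃ x ∈ (F.D 0).Ψ v hv, x ≠ 0) ∧
        (∀ (j : T.Label) (vQ : T.VQ), ((F.D 0).shellPk j vQ).Nonempty ∧
          (F.D 0).shellPk j vQ ≠ Set.univ) :=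
  ⟨toyIndex, nvFull, nvSetting, nvFull_statement, nvSetting_bridgeHyps, nvSetting_absLogQPos,
    nvSetting_thetaRegionsAdm, capstone_at_nv, nvSetting_not_qFrobEqualityAt,
    nvSetting_not_qFrobComparison, nvSetting_not_statement,
    ⟨negFamily, negFamily_mem_Ind2Family, 0, (), nvUnit 0 (), negFamily_ne_id ()⟩,
    nv_psi_nonempty,
    fun j vQ => ⟨(nv_shellPk_proper j vQ).1, (nv_shellPk_proper j vQ).2.1⟩⟩

end CapstoneWitness

end Cor312Vol

end IUTFork

end Summit.ABC

end
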